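import Mathlib
import HarnessLib

/-!
# `NoHeavyLowerTail` (crux stmt-CriticalPhenomena-4575), antithetic vdBHK programme: TOOLS for the VIRTUAL CROWN LEMMA (THEOREM COβ engine)

Support file (seat `prim-ineq-gen-7` gen 48; `--supports stmt-CriticalPhenomena-4575`).  No `sorry`, no definitions.
Memo: run/shared/lean/prim/prim-ineq-gen-7/PROOF-COBETA-g48.md §4.  Two abstract lemmas used by `…AntitheticVirtualCrown`:
* `AntitheticVirtualCrownTools.lab_split` — the Λ-label of a (possibly virtual) top whose interior test reads a set `T ∋ p, q` equals the certificate's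
  `labC own (s p) (s q) [T∖{p,q} red] [T∖{p,q} blue]`;
* `AntitheticVirtualCrownTools.fibre_sum` — the NORMALISED FIBRE IDENTITY: for five distinct elements `a,b,c,x,z`, a non-empty set `S` disjoint from them,
  a colour function `cy` depending only on `S`, self-dual and red on 'S all red', and any weight `W` that depends only on the coordinates off the five and
  `S` and on whether the colouring is constant on `S`:  `Σ_s G(κ s, W s) = Σ_{j ∈ JS} Σ_{k<64} G(k, W j)`, where `κ s` is the 6-bit code of
  `(s a, s b, s c, s x, cy s, s z)` and `JS` the normalised colourings (five red; `S` red, or `S` mixed with `cy` red).  Each fibre of the normalisation is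
  64 colourings on which `κ` is a bijection onto `[0, 64)` — bit 4 (`cy`) records 'S red vs S blue' on the constant fibres and 's vs s flipped on S' on the
  mixed ones (self-duality).
-/

namespace Summit.CriticalPhenomena.PercolationContinuityZ3.Theorems

open Finset

namespace AntitheticVirtualCrownTools

variable {E : Type*} [Fintype E] [DecidableEq E]

/-- The label of a top whose interior test reads the set `T` (containing the two atoms `p ≠ q` it covers) is the certificate's `labC` applied to its own
colour, the colours of `p, q` and the two junk flags of `T ∖ {p, q}`. [this work] -/
theorem lab_split
    (labC : Bool → Bool → Bool → Bool → Bool → ℕ)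
    (hlabC : labC = fun own p q rj bj => if own then (if p && q && rj then 0 else 1) else (if !p && !q && bj then 3 else 2))
    (T : Finset E) (own : Bool) (p q : E) (J : Finset E) (hp : p ∈ T) (hq : q ∈ T) (hJ : J = T.filter (fun d => d ≠ p ∧ d ≠ q))
    (s : E → Bool) :
    (if own = true then (if ∀ d ∈ T, s d = true then 0 else 1) else (if ∀ d ∈ T, s d = false then 3 else 2)) =
      labC own (s p) (s q) (decide (∀ d ∈ J, s d = true)) (decide (∀ d ∈ J, s d = false)) := by
  have hsplit : ∀ v : Bool, (∀ d ∈ T, s d = v) ↔ (s p = v ∧ s q = v ∧ ∀ d ∈ J, s d = v) := by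
    intro v
    constructor
    · intro h
      refine ⟨h p hp, h q hq, fun d hd => h d ?_⟩
      rw [hJ] at hd; exact (Finset.mem_filter.1 hd).1
    · rintro ⟨h1, h2, h3⟩ d hd
      by_cases hdp : d = p; · rw [hdp]; exact h1
      by_cases hdq : d = q; · rw [hdq]; exact h2
      exact h3 d (by rw [hJ]; exact Finset.mem_filter.2 ⟨hd, hdp, hdq⟩)
  rw [hlabC]
  dsimp only
  rw [if_congr (hsplit true) rfl rfl, if_congr (hsplit false) rfl rfl]
  cases own <;> cases s p <;> cases s q <;> by_cases hJ1 : (∀ d ∈ J, s d = true) <;> by_cases hJ2 : (∀ d ∈ J, s d = false) <;>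
    simp [hJ1, hJ2]

/-- **Normalised fibre identity** (PROOF-COBETA-g48 §4).  See the module docstring. [this work] -/
theorem fibre_sum
    (enc6 : Bool → Bool → Bool → Bool → Bool → Bool → ℕ)
    (henc : enc6 = fun p0 p1 p2 p3 p4 p5 => (if p0 then 1 else 0) + (if p1 then 2 else 0) + (if p2 then 4 else 0) + (if p3 then 8 else 0) +
      (if p4 then 16 else 0) + (if p5 then 32 else 0))
    (a b c x z : E) (hab : a ≠ b) (hac : a ≠ c) (hax : a ≠ x) (haz : a ≠ z) (hbc : b ≠ c) (hbx : b ≠ x) (hbz : b ≠ z)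
    (hcx : c ≠ x) (hcz : c ≠ z) (hxz : x ≠ z)
    (five S : Finset E) (hfive : five = {a, b, c, x, z}) (hdisj : ∀ e ∈ five, e ∉ S) (hSne : S.Nonempty)
    (cy : (E → Bool) → Bool)
    (hcyS : ∀ s t : E → Bool, (∀ e ∈ S, s e = t e) → cy s = cy t)
    (hcyc : ∀ s : E → Bool, cy (fun e => !s e) = !cy s)
    (hcyr : ∀ s : E → Bool, (∀ e ∈ S, s e = true) → cy s = true)
    (JS : Finset (E → Bool))
    (hJS : JS = Finset.univ.filter (fun j => (∀ e ∈ five, j e = true) ∧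
      ((∀ e ∈ S, j e = true) ∨ (¬ ((∀ e ∈ S, j e = true) ∨ (∀ e ∈ S, j e = false)) ∧ cy j = true))))
    (W : (E → Bool) → ℕ) (hW : ∀ s t : E → Bool, (∀ e, e ∉ five → e ∉ S → s e = t e) →
      (((∀ e ∈ S, s e = true) ∨ (∀ e ∈ S, s e = false)) ↔ ((∀ e ∈ S, t e = true) ∨ (∀ e ∈ S, t e = false))) → W s = W t)
    (G : ℕ → ℕ → ℤ) :
    ∑ s, G (enc6 (s a) (s b) (s c) (s x) (cy s) (s z)) (W s) = ∑ j ∈ JS, ∑ k ∈ Finset.range 64, G k (W j) := by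
  classical
  set unif : (E → Bool) → Prop := fun s => (∀ e ∈ S, s e = true) ∨ (∀ e ∈ S, s e = false) with hunif
  -- bits of the encoding
  have hbits : ∀ p0 p1 p2 p3 p4 p5 : Bool,
      (enc6 p0 p1 p2 p3 p4 p5).testBit 0 = p0 ∧ (enc6 p0 p1 p2 p3 p4 p5).testBit 1 = p1 ∧ (enc6 p0 p1 p2 p3 p4 p5).testBit 2 = p2 ∧
      (enc6 p0 p1 p2 p3 p4 p5).testBit 3 = p3 ∧ (enc6 p0 p1 p2 p3 p4 p5).testBit 4 = p4 ∧ (enc6 p0 p1 p2 p3 p4 p5).testBit 5 = p5 ∧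
      enc6 p0 p1 p2 p3 p4 p5 < 64 := by
    subst henc; decide
  have henc_of : ∀ k : Fin 64, enc6 (k.val.testBit 0) (k.val.testBit 1) (k.val.testBit 2) (k.val.testBit 3) (k.val.testBit 4) (k.val.testBit 5) = k.val := by
    subst henc; decide
  set κ : (E → Bool) → ℕ := fun s => enc6 (s a) (s b) (s c) (s x) (cy s) (s z) with hκ
  have hmem_five : ∀ e, e ∈ five ↔ e = a ∨ e = b ∨ e = c ∨ e = x ∨ e = z := by
    intro e; rw [hfive]; simp
  have haF : a ∈ five := (hmem_five a).2 (Or.inl rfl)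
  have hbF : b ∈ five := (hmem_five b).2 (Or.inr (Or.inl rfl))
  have hcF : c ∈ five := (hmem_five c).2 (Or.inr (Or.inr (Or.inl rfl)))
  have hxF : x ∈ five := (hmem_five x).2 (Or.inr (Or.inr (Or.inr (Or.inl rfl))))
  have hzF : z ∈ five := (hmem_five z).2 (Or.inr (Or.inr (Or.inr (Or.inr rfl))))
  have hcy_blue : ∀ s : E → Bool, (∀ e ∈ S, s e = false) → cy s = false := by
    intro s hs
    have h1 : cy (fun e => !s e) = true := hcyr _ (fun e he => by simp [hs e he])
    rw [hcyc] at h1; simpa using h1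
  -- flipping S
  set flS : (E → Bool) → (E → Bool) := fun s => fun e => if e ∈ S then !s e else s e with hflS
  have hcy_flS : ∀ s, cy (flS s) = !cy s := by
    intro s; rw [← hcyc s]; apply hcyS; intro e he; simp [hflS, he]
  have hunif_congr : ∀ s t : E → Bool, (∀ e ∈ S, s e = t e) → (unif s ↔ unif t) := by
    intro s t h; rw [hunif]; dsimp only
    constructor
    · rintro (h1 | h1)
      · exact Or.inl (fun e he => (h e he) ▸ h1 e he)
      · exact Or.inr (fun e he => (h e he) ▸ h1 e he)
    · rintro (h1 | h1)
      · exact Or.inl (fun e he => (h e he).symm ▸ h1 e he)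
      · exact Or.inr (fun e he => (h e he).symm ▸ h1 e he)
  have hunif_flip : ∀ s t : E → Bool, (∀ e ∈ S, s e = !t e) → (unif s ↔ unif t) := by
    intro s t h; rw [hunif]; dsimp only
    constructor
    · rintro (h1 | h1)
      · exact Or.inr (fun e he => by have := h1 e he; rw [h e he] at this; simpa using this)
      · exact Or.inl (fun e he => by have := h1 e he; rw [h e he] at this; simpa using this)
    · rintro (h1 | h1)
      · exact Or.inr (fun e he => by rw [h e he, h1 e he]; rfl)
      · exact Or.inl (fun e he => by rw [h e he, h1 e he]; rfl)
  obtain ⟨e0, he0⟩ := hSne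
  have hred_not_mixed : ∀ j : E → Bool, (∀ e ∈ S, j e = true) → unif j := fun j h => by rw [hunif]; exact Or.inl h
  -- the normalisation
  set φ : (E → Bool) → (E → Bool) := fun s => fun e =>
    if e ∈ five then true else if e ∈ S then (if unif s then true else (if cy s = true then s e else !s e)) else s e with hφ
  have hφ_five : ∀ s e, e ∈ five → φ s e = true := by intro s e he; simp [hφ, he]
  have hφ_off : ∀ s e, e ∉ five → e ∉ S → φ s e = s e := by intro s e h1 h2; simp [hφ, h1, h2]
  have hφ_S : ∀ s e, e ∈ S → φ s e = (if unif s then true else (if cy s = true then s e else !s e)) := by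
    intro s e he
    have h1 : e ∉ five := fun h => hdisj e h he
    simp only [hφ, h1, if_false, he, if_true]
  have hunif_φ : ∀ s, unif (φ s) ↔ unif s := by
    intro s
    by_cases hu : unif s
    · refine ⟨fun _ => hu, fun _ => hred_not_mixed _ (fun e he => by rw [hφ_S s e he, if_pos hu])⟩
    · by_cases hcs : cy s = true
      · exact hunif_congr (φ s) s (fun e he => by rw [hφ_S s e he, if_neg hu, if_pos hcs])
      · rw [hunif_flip (φ s) s (fun e he => by rw [hφ_S s e he, if_neg hu, if_neg hcs])]
  have hcy_φ_mixed : ∀ s, ¬ unif s → cy (φ s) = true := by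
    intro s hu
    by_cases hcs : cy s = true
    · rw [← hcs]; apply hcyS; intro e he; rw [hφ_S s e he, if_neg hu, if_pos hcs]
    · have : cy (φ s) = cy (flS s) := hcyS _ _ (fun e he => by rw [hφ_S s e he, if_neg hu, if_neg hcs]; simp [hflS, he])
      rw [this, hcy_flS]; simpa using hcs
  have hφ_mem : ∀ s ∈ (Finset.univ : Finset (E → Bool)), φ s ∈ JS := by
    intro s _
    rw [hJS, Finset.mem_filter]
    refine ⟨Finset.mem_univ _, fun e he => hφ_five s e he, ?_⟩
    by_cases hu : unif s
    · exact Or.inl (fun e he => by rw [hφ_S s e he, if_pos hu])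
    · exact Or.inr ⟨fun h => hu ((hunif_φ s).1 h), hcy_φ_mixed s hu⟩
  have hW_φ : ∀ s, W (φ s) = W s := fun s => hW _ _ (fun e h1 h2 => hφ_off s e h1 h2) (hunif_φ s)
  -- the inverse of κ on a fibre
  set ext : (E → Bool) → ℕ → (E → Bool) := fun j k => fun e =>
    if e = a then k.testBit 0 else if e = b then k.testBit 1 else if e = c then k.testBit 2 else if e = x then k.testBit 3 else if e = z then k.testBit 5 else
    if e ∈ S then (if (∀ e ∈ S, j e = true) then k.testBit 4 else (if k.testBit 4 = true then j e else !j e)) else j e with hext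
  have hext_a : ∀ j k, ext j k a = k.testBit 0 := by intro j k; simp [hext]
  have hext_b : ∀ j k, ext j k b = k.testBit 1 := by intro j k; simp [hext, hab.symm]
  have hext_c : ∀ j k, ext j k c = k.testBit 2 := by intro j k; simp [hext, hac.symm, hbc.symm]
  have hext_x : ∀ j k, ext j k x = k.testBit 3 := by intro j k; simp [hext, hax.symm, hbx.symm, hcx.symm]
  have hext_z : ∀ j k, ext j k z = k.testBit 5 := by intro j k; simp [hext, haz.symm, hbz.symm, hcz.symm, hxz.symm]
  have hext_S : ∀ j k e, e ∈ S → ext j k e = (if (∀ e ∈ S, j e = true) then k.testBit 4 else (if k.testBit 4 = true then j e else !j e)) := by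
    intro j k e he
    have h1 : e ∉ five := fun h => hdisj e h he
    rw [hmem_five] at h1; push Not at h1
    obtain ⟨n1, n2, n3, n4, n5⟩ := h1
    simp only [hext, n1, n2, n3, n4, n5, if_false, he, if_true]
  have hext_off : ∀ j k e, e ∉ five → e ∉ S → ext j k e = j e := by
    intro j k e he heS
    rw [hmem_five] at he; push Not at he
    obtain ⟨n1, n2, n3, n4, n5⟩ := he
    simp only [hext, n1, n2, n3, n4, n5, if_false, heS]
  have hcy_ext : ∀ j ∈ JS, ∀ k, cy (ext j k) = k.testBit 4 := by
    intro j hj k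
    rw [hJS, Finset.mem_filter] at hj
    obtain ⟨-, -, hjS⟩ := hj
    by_cases hr : ∀ e ∈ S, j e = true
    · have hconst : ∀ e ∈ S, ext j k e = k.testBit 4 := fun e he => by rw [hext_S j k e he, if_pos hr]
      cases hk : k.testBit 4
      · exact hcy_blue _ (fun e he => by rw [hconst e he, hk])
      · exact hcyr _ (fun e he => by rw [hconst e he, hk])
    · rcases hjS with h | ⟨hmix, hcj⟩
      · exact (hr h).elim
      cases hk : k.testBit 4
      · have : cy (ext j k) = cy (flS j) := hcyS _ _ (fun e he => by rw [hext_S j k e he, if_neg hr, hk]; simp [hflS, he])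
        rw [this, hcy_flS, hcj]; rfl
      · rw [← hcj]; exact hcyS _ _ (fun e he => by rw [hext_S j k e he, if_neg hr, hk, if_pos rfl])
  -- ### the fibrewise computation
  rw [← Finset.sum_fiberwise_of_maps_to (s := Finset.univ) (t := JS) (g := φ) hφ_mem]
  refine Finset.sum_congr rfl (fun j hj => ?_)
  have hj' := hj
  rw [hJS, Finset.mem_filter] at hj'
  obtain ⟨-, hj5, hjS⟩ := hj'
  refine Finset.sum_nbij' (fun s => κ s) (fun k => ext j k) ?_ ?_ ?_ ?_ ?_
  · intro s _; exact Finset.mem_range.2 (hbits _ _ _ _ _ _).2.2.2.2.2.2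
  · -- ext j k lies in the fibre of j
    intro k hk
    simp only [Finset.mem_filter, Finset.mem_univ, true_and]
    funext e
    by_cases he : e ∈ five
    · rw [hφ_five _ e he, hj5 e he]
    by_cases heS : e ∈ S
    · rw [hφ_S _ e heS]
      by_cases hr : ∀ e ∈ S, j e = true
      · have hu : unif (ext j k) := by
          rw [hunif]; dsimp only
          cases hk4 : k.testBit 4
          · exact Or.inr (fun e he => by rw [hext_S j k e he, if_pos hr, hk4])
          · exact Or.inl (fun e he => by rw [hext_S j k e he, if_pos hr, hk4])
        rw [if_pos hu, hr e heS]
      · rcases hjS with h | ⟨hmix, hcj⟩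
        · exact (hr h).elim
        have hnu : ¬ unif (ext j k) := by
          cases hk4 : k.testBit 4
          · rw [hunif_flip (ext j k) j (fun e he => by rw [hext_S j k e he, if_neg hr, hk4]; rfl)]; exact hmix
          · rw [hunif_congr (ext j k) j (fun e he => by rw [hext_S j k e he, if_neg hr, hk4, if_pos rfl])]; exact hmix
        rw [if_neg hnu, hcy_ext j hj k, hext_S j k e heS, if_neg hr]
        cases k.testBit 4 <;> simp
    · rw [hφ_off _ e he heS, hext_off j k e he heS]
  · -- ext j (κ s) = s on the fibre
    intro s hs
    simp only [Finset.mem_filter, Finset.mem_univ, true_and] at hs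
    obtain ⟨k0, k1, k2, k3, k4, k5, -⟩ := hbits (s a) (s b) (s c) (s x) (cy s) (s z)
    funext e
    by_cases he : e ∈ five
    · rw [hmem_five] at he
      rcases he with rfl | rfl | rfl | rfl | rfl
      · show ext j (κ s) _ = _; rw [hext_a, k0]
      · show ext j (κ s) _ = _; rw [hext_b, k1]
      · show ext j (κ s) _ = _; rw [hext_c, k2]
      · show ext j (κ s) _ = _; rw [hext_x, k3]
      · show ext j (κ s) _ = _; rw [hext_z, k5]
    by_cases heS : e ∈ S
    · show ext j (κ s) e = s e
      rw [hext_S j _ e heS, k4]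
      have hjS' : ∀ e ∈ S, j e = (if unif s then true else (if cy s = true then s e else !s e)) := fun e he => by rw [← hs, hφ_S s e he]
      by_cases hu : unif s
      · have hr : ∀ e ∈ S, j e = true := fun e he => by rw [hjS' e he, if_pos hu]
        rw [if_pos hr]
        rw [hunif] at hu
        rcases hu with h | h
        · rw [hcyr s h, h e heS]
        · rw [hcy_blue s h, h e heS]
      · have hr : ¬ ∀ e ∈ S, j e = true := by
          intro hr; apply hu
          by_cases hcs : cy s = true
          · exact (hunif_congr j s (fun e he => by rw [hjS' e he, if_neg hu, if_pos hcs])).1 (hred_not_mixed j hr)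
          · exact (hunif_flip j s (fun e he => by rw [hjS' e he, if_neg hu, if_neg hcs])).1 (hred_not_mixed j hr)
        rw [if_neg hr, hjS' e heS, if_neg hu]
        cases cy s <;> simp
    · show ext j (κ s) e = s e
      rw [hext_off j _ e he heS, ← hs, hφ_off s e he heS]
  · -- κ (ext j k) = k
    intro k hk
    have hk64 : k < 64 := Finset.mem_range.1 hk
    have := henc_of ⟨k, hk64⟩
    simp only at this
    show enc6 (ext j k a) (ext j k b) (ext j k c) (ext j k x) (cy (ext j k)) (ext j k z) = k
    rw [hext_a, hext_b, hext_c, hext_x, hcy_ext j hj k, hext_z, this]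
  · -- the weight is constant on the fibre
    intro s hs
    simp only [Finset.mem_filter, Finset.mem_univ, true_and] at hs
    show G (κ s) (W s) = G (κ s) (W j)
    rw [← hs, hW_φ]

end AntitheticVirtualCrownTools

end Summit.CriticalPhenomena.PercolationContinuityZ3.Theorems
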